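import Summits.QuantumFields.BalabanUV.T4Continuum.Support.ShellMeasureScalingSUN
import Summits.QuantumFields.BalabanUV.T4Continuum.Support.ShellMeasureExpJacobianSUN

/-!
# `T4Continuum.ShellMeasureRealizedSUN` — the realized (M1) engine for `G = SU(N)` with the EXPLICIT exponential
# Haar Jacobian: exactly ONE located binder beyond the `SU(2)` case, the one-bond chart identity (CH)₁
# (cell `pub-balaban`, sub-cell `t4`, spine estimate NE7c (node U5b); ROUND-2 crew `t4-ne7c-formalise-*`, row S3
# «SM-L9 SU(N) chart» of `t4/b2b-balaban-t4-ne7c-p1/LEAVES-NE7c-P1.md` (trigger `t4/T4-NE7c-TRIGGER.json`, c5: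
# optional and last — `SU(2)` is the row's certified instance); seat `b2b-balaban-t4-ne7c-formalise-leaf-04`; v1.1 (v1 =
# p209487; v1.1 adds two docstring paragraphs asked by the crew's XREADs, declarations byte-identical); file 5 of
# the row = the wiring of file 2 (`ShellMeasureScalingSUN`: (CH) reduced to one bond, realized headline) with file 4
# (`ShellMeasureExpJacobianSUN`: the root-space Jacobian, measurable and centre-monotone); tree target
# `Summits/QuantumFields/BalabanUV/T4Continuum/Support/`; ADDITIVE — imports those two and modifies nothing)

HONEST FRAMING.  Finite four-torus programme, rung (B)+1 only — NOT infinite volume, NOT a mass gap, NOT the Clay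
problem, NOT summit progress; (B), `BetaPertHyp`, (B^μ) are not mentioned because nothing here consumes them.  The
cell wall of NE7c — (M1) `T4ShellMeasure.SlotAntiConcentration` FOR BAŁABAN'S INDUCTIVELY DEFINED EFFECTIVE MEASURES —
is NOT PRINTED in [Balaban 1983–89] (GAPS G-ne7cp1-1), asserted by nobody, and NOT moved by this file; a landed S3
changes NOTHING in the countdown (spine PROVED 0/9); the result reads «(M1) for the realized `SU(N)` law ⇐ the named
binders», never «NE7c proved».  [folklore] kernel composition, 0 sorry, 0 citations, no `def … : Prop`.
HONEST DEPENDENCY: continuum YM on T⁴ ⇐ BetaPertH ∧ nine spine estimates (0/9 proved); BetaPertH ⇐ (D1) ∧ (D4) ∧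
CAP+tail; G-an2-4 gates asym, D1 and NE2/3/4.

THE POINT.  `slotAntiConcentration_realized_suN_expJac`: the `SU(N)` realized headline of `ShellMeasureScalingSUN`
with the one-bond chart weight INSTANTIATED to `J₁ = κ · expJacSU` (`ShellMeasureExpJacobianSUN.expJacWeightSU κ`;
`κ` the normalising constant) on a window of radius `S ≤ π`: its binders `hJ₁` (measurability) and `hJ₁c`
(centre-monotonicity) are DISCHARGED by `measurable_expJacWeightSU` / `expJacWeightSU_le_smul`, so that — besides the
data every member carries (window factorisation `hFw`, per-section finiteness `hfin`, core map `hcore` (S-i),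
ray-weight loss `hden` (S-ii)) — the ONLY located input of the `SU(N)` engine beyond the tree's `SU(2)` case is the
ONE-BOND CHART IDENTITY AT THE IDENTITY

  (CH)₁  `Haar_{SU(N)}|_{exp(B̄_S)} = expPtSU_* (volume|_{B̄_S} · κ·expJacSU)`,   `0 ≤ S ≤ π`,

i.e. the classical statement that the normalised Haar measure of `SU(N)` pulled back by the exponential map has, with
respect to the Lebesgue measure of (`𝔰𝔲(N)`, Hilbert–Schmidt), the density `κ·|j(X)|²`,
`|j(X)|² = det_{𝔰𝔲(N)}((1 − e^{−ad X})/ad X) = ∏_{α} (1 − e^{−α(H)})/α(H) = ∏_{i<j} sinc²((θ_i−θ_j)/2)` (Helgason,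
*Groups and Geometric Analysis*, AMS 2000, Ch. V §1, eq. (23) and Thm 1.10 — a LOCATOR for the displayed binder,
not a citation tag: nothing is asserted), together with the injectivity of `exp` on the ball (`S < π` in operator
norm).  For `N = 2` the tree PROVES the cube-coordinate form (`T4HaarSU2ExpChart`,
`T4CubeChartExp.cubeChart_specialUnitaryTwo_exp`, consumed by `ShellMeasureScalingSU2.chart_su2`); for `N ≥ 3` (CH)₁
is NOT in Mathlib or the tree and stays DISPLAYED.  The determinant formula `expJacSU` agrees with `|j|²` off the
closed null cone of non-regular generators (`expJacSU_eq_prod_sinc`) and is `0` on it — immaterial for a density.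
CAVEAT (crew XREAD of file 4, INFO-2): the cone CONTAINS the chart centre `v = 0`, where the continuous Jacobian
`|j|²` equals `1` while `expJacSU 0 = 0`; (CH)₁ (an a.e. statement), `hJ₁c` (pointwise true for `0 < c ≤ 1`) and
`0 ≤ J ≤ 1` are unaffected, but a consumer that needs continuity of the density or the value `J(0) = 1` (e.g. to PIN
the constant `κ` by the density at the identity) must use the continuous extension `|j|²`, not `expJacSU`, there.

WHAT THIS DOES NOT DO.  (CH)₁ for `N ≥ 3`; any instance of (S-i)/(S-ii) for Bałaban's localized minimisers / block
weights; (Det), (FI-sat), (LR), (MR), (W1), the (F∞)-rate keep their status.  NE7c NOT proved.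
-/

noncomputable section

namespace Summit.QuantumFields.BalabanUV.T4Continuum.ShellMeasureRealizedSUN

open MeasureTheory Set Function Metric
open scoped ENNReal
open Literature.MathematicalPhysics.QuantumFieldTheory.Balaban1983to89
open T4ShellMeasure (SlotAntiConcentration)
open T4ShellMeasureDet (blockLaw)
open ShellMeasureExpChartSUN ShellMeasureScalingSUN ShellMeasureExpJacobianSUN

variable {N : ℕ} [NeZero N] {P : Params} {j : ℕ} [DecidableEq (PBond P j)]

/-- **THE REALIZED ENGINE FOR `G = SU(N)` WITH THE EXPLICIT EXPONENTIAL HAAR JACOBIAN.**  Data: the bonds `Λ` of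
the slot's block; a window radius `0 ≤ S ≤ π`; the normalising constant `κ` and the ONE-BOND CHART IDENTITY (CH)₁
`hCH` for the weight `κ·expJacSU` (DISPLAYED — NOT in the tree for `N ≥ 3`); for every exterior `V` a chart centre
`c V` and a measurable block weight `R V`; the realized density `F` with the window factorisation `hFw`; per-section
finiteness; the tested variable `u`; numbers `θ, ρ ≥ 0`, a depth `a ≥ 0`, `B_f`, and `D` with `(#Λ·d_N + B_f)·a ≤ D·ρ`;
the analytic hypotheses (S-i) `hcore` and (S-ii) `hden` on the block weight ALONE, in the window, on the support,
below the threshold.  CONCLUSION: (M1) `SlotAntiConcentration ((fieldMeasure P j SU(N)).withDensity F) u θ ρ D`.  The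
Jacobian's measurability and centre-monotonicity are theorems (`ShellMeasureExpJacobianSUN`), not binders. [folklore] -/
theorem slotAntiConcentration_realized_suN_expJac (Λ : Finset (PBond P j)) {S : ℝ} (hS : 0 ≤ S) (hSπ : S ≤ Real.pi)
    (κ : ℝ≥0∞)
    (hCH : (HaarData.haar : Measure (SUN N)).restrict (expBallSU S) =
      (((volume : Measure (ChartSU N)).restrict (closedBall 0 S)).withDensity (expJacWeightSU κ)).map expPtSU)
    (c : GaugeField P j (SUN N) → GaugeField P j (SUN N))
    {R : GaugeField P j (SUN N) → (↥Λ → SUN N) → ℝ≥0∞} (hR : ∀ V, Measurable (R V))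
    {F : GaugeField P j (SUN N) → ℝ≥0∞} (hF : Measurable F)
    (hFw : ∀ V y, F (updateFinset V Λ y) = windowSU Λ (c V) S y * R V y)
    (hfin : ∀ V, ((blockLaw Λ).withDensity fun y => F (updateFinset V Λ y)) univ ≠ ∞)
    {u : GaugeField P j (SUN N) → ℝ} (hu : Measurable u) {θ ρ a Bf D : ℝ} (hθ : 0 ≤ θ) (hρ : 0 ≤ ρ) (ha : 0 ≤ a)
    (haD : ((Λ.card * dimSU N : ℕ) + Bf) * a ≤ D * ρ)
    (hcore : ∀ V x, x ∈ closedBall (0 : BlockChartSU N Λ) S → R V (expFibreChartSU Λ (c V) x) ≠ 0 →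
      u (updateFinset V Λ (expFibreChartSU Λ (c V) x)) < θ →
      u (updateFinset V Λ (expFibreChartSU Λ (c V) (Real.exp (-a) • x))) < θ * (1 - ρ))
    (hden : ∀ V x, x ∈ closedBall (0 : BlockChartSU N Λ) S → R V (expFibreChartSU Λ (c V) x) ≠ 0 →
      u (updateFinset V Λ (expFibreChartSU Λ (c V) x)) < θ →
      R V (expFibreChartSU Λ (c V) x) ≤
        ENNReal.ofReal (Real.exp (Bf * a)) * R V (expFibreChartSU Λ (c V) (Real.exp (-a) • x))) :
    SlotAntiConcentration ((fieldMeasure P j (SUN N)).withDensity F) u θ ρ D :=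
  slotAntiConcentration_realized_suN_of_coreMap Λ hS (measurable_expJacWeightSU κ) (expJacWeightSU_le_smul κ hSπ)
    hCH c hR hF hFw hfin hu hθ hρ ha haD hcore hden

omit [NeZero N] in
/-- the chart-side law of (CH)₁ with the explicit Jacobian is FINITE unconditionally (`J₁ ≤ κ` on a bounded ball) —
so the finiteness built into (CH)₁ (`ShellMeasureScalingSUN.isFiniteMeasure_of_hCH`) is no extra constraint for
`κ < ∞`. [folklore] -/
theorem chartLaw_expJac_univ_le (κ : ℝ≥0∞) (S : ℝ) :
    (((volume : Measure (ChartSU N)).restrict (closedBall 0 S)).withDensity (expJacWeightSU κ)) univ ≤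
      κ * volume (closedBall (0 : ChartSU N) S) := by
  rw [withDensity_apply _ MeasurableSet.univ, Measure.restrict_univ]
  calc ∫⁻ v in closedBall (0 : ChartSU N) S, expJacWeightSU κ v
      ≤ ∫⁻ _ in closedBall (0 : ChartSU N) S, κ := lintegral_mono fun v => expJacWeightSU_le κ v
    _ = κ * volume (closedBall (0 : ChartSU N) S) := by rw [lintegral_const, Measure.restrict_apply_univ]

end Summit.QuantumFields.BalabanUV.T4Continuum.ShellMeasureRealizedSUN

end
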